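import Summits.AtomisticToContinuum.Crystallization.Theorems.ThreeConeCertificateSlackRigidityPalmReduction
import Summits.AtomisticToContinuum.Crystallization.Theorems.ThreeConeCertificateSlackRigidityUniqFinal
import Summits.AtomisticToContinuum.Crystallization.Theorems.PalmUnimodularRigidityCruxesToPalmRigidity
import Summits.AtomisticToContinuum.Crystallization.Theorems.PalmUnimodularRigidityShellsToBarlowChart
import HarnessLib

/-!
# Crux `SlackRigidity` (stmt-AtomisticToContinuum-11960), line `ekeland-surgery-parity`:
# the crux as a ONE-HYPOTHESIS implication from filed items, kernel-checked

Route `ThreeConeCertificate`, sub-problem `Crystallization`.  The line `ekeland-surgery-parity`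
(leads c1 → c4) is complete modulo its single registered stub `stub_palmRigidity : PalmRigidity`,
the target decl of route `PalmUnimodularRigidity` (item stmt-AtomisticToContinuum-9224) BY NAME.
This file records that state as theorems whose hypotheses are route decls by name and nothing else:

* `slackRigidity_of_palmRigidity : PalmRigidity → SlackRigidity` — the landed Palm reduction
  `EkelandSurgeryParityReduction.slackRigidity_of_palmRigidity_of_hcpOptimalCongruent` (p112833) with
  its second hypothesis discharged by the landed certified-numerics uniqueness of the relaxed-hcp
  optimum `EkelandSurgeryParityUniqFinal.stub_hcpOptimalCongruent` (p115896);
* `slackRigidity_of_minimiserShells_of_layeredLawsSelectHcp :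
  MinimiserShells → LayeredLawsSelectHcp → SlackRigidity` — the same, composed with the landed glue
  `cruxesToPalmRigidity_proof : MinimiserShells → ShellsToBarlowChart → LayeredLawsSelectHcp →
  PalmRigidity` (item 9228) and the landed proof `ShellsToBarlowChart_of` of crux 9227; so the crux
  11960 is, in the tree, implied by the two OPEN cruxes 9225 (`MinimiserShells`) and 9226
  (`LayeredLawsSelectHcp`) of route `PalmUnimodularRigidity`, and by nothing weaker that is filed.

When `PalmRigidity` (equivalently 9225 ∧ 9226) is proved, the crux closes by the one-line file
`theorem SlackRigidity_proof : SlackRigidity := slackRigidity_of_palmRigidity PalmRigidity_holds`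
(`--workitem stmt-AtomisticToContinuum-11960`). [folklore]
-/

noncomputable section

namespace Summit.AtomisticToContinuum.Crystallization.Theorems.EkelandSurgeryParityClosure

open Summit.AtomisticToContinuum.Crystallization.Theses.ThreeConeCertificate (SlackRigidity)
open Summit.AtomisticToContinuum.Crystallization.Theses.PalmUnimodularRigidity
  (PalmRigidity MinimiserShells LayeredLawsSelectHcp ShellsToBarlowChart)
open Summit.AtomisticToContinuum.Crystallization.Theorems

/-- **`PalmRigidity ⇒ SlackRigidity`** (crux stmt-AtomisticToContinuum-11960 from the target
stmt-AtomisticToContinuum-9224 of route `PalmUnimodularRigidity`, by name): the landed Palm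
reduction of line `ekeland-surgery-parity` with its computational hypothesis (uniqueness of the
relaxed-hcp optimum up to congruence) discharged by the landed certificate.  CONDITIONAL on the
open item 9224, which enters only as the hypothesis. [folklore] -/
theorem slackRigidity_of_palmRigidity : PalmRigidity → SlackRigidity := fun hPalm =>
  EkelandSurgeryParityReduction.slackRigidity_of_palmRigidity_of_hcpOptimalCongruent
    hPalm EkelandSurgeryParityUniqFinal.stub_hcpOptimalCongruent

/-- **`MinimiserShells ⇒ LayeredLawsSelectHcp ⇒ SlackRigidity`** (crux 11960 from the two open
cruxes 9225 and 9226 of route `PalmUnimodularRigidity`, by name): `slackRigidity_of_palmRigidity`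
composed with the landed glue `cruxesToPalmRigidity_proof` (item 9228) and the landed proof
`ShellsToBarlowChart_of` of crux 9227. [folklore] -/
theorem slackRigidity_of_minimiserShells_of_layeredLawsSelectHcp :
    MinimiserShells → LayeredLawsSelectHcp → SlackRigidity := fun hShells hSelect =>
  slackRigidity_of_palmRigidity
    (PalmUnimodularRigidity.cruxesToPalmRigidity_proof hShells
      Cruxes.ShellsToBarlowChart.DevelopTheModelGrowthDescent.ShellsToBarlowChart_of hSelect)

end Summit.AtomisticToContinuum.Crystallization.Theorems.EkelandSurgeryParityClosure

end
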